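import Summits.Ventures.PercRepro.PuncturedLYMChainInstances

/-!
# PercRepro — (SP) BY SUPERPOSITION, PART 11: THE NEGATIVE-ERROR CERTIFICATE — THE RE-ROUTING DECREASE THROUGH THE
WORDS THROUGH A POINT (p10, gen 31)

The decrease of the re-routing at a completion `X ↦ insert y X` from a near word `B` (`X = (B ∖ b) ∪ x`) is at most
`errE(x)⁻/j` when `y ≠ b` (PuncturedLYMReroute), and the NEGATIVE error at `x` comes only from the words THROUGH `x`:
`errE(x)⁻ ≤ Σ_{B' ∋ x, B' ≠ B} g(#(B ∩ B'))/(n − j)`, `g(a) = (n − 2j + a)·d(a)` (`errE_neg_le`).  The words through `x` at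
distance `a` and `a + 1` from `B` compete for the `(j−1)`-sets through `x` meeting `B` in `a` points
(`card_through_pair_le`: `(j − 1 − a)·m'_a + (a + 1)·m'_{a+1} ≤ C(j,a)·C(n−j−1, j−2−a)`), so any nonnegative `μ` with
`g(a) ≤ (j − 1 − a)·μ_a + a·μ_{a−1}` certifies `Σ_{B' ∋ x} g ≤ Σ_{a<j−1} μ_a·s'_a` (`sum_gDef_through_le_of_cert`, from the
abstract `cert_sum_le`).  At most one near word has `b = y` (its decrease is `≤ errE(x)⁺/j`), so
`Σ_B reroute ≥ −(M⁺ + (j − 1)·M⁻)/j`.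
THIS FILE: the abstract certificate inequality `cert_sum_le`, `gDef`, the words through a point (`throughCount`,
`midSetsAt`, `card_midSetsAt_le`, `pairsAt`) and THE JOINT PACKING COUNT THROUGH A POINT `card_through_pair_le`.
The certificate bound for the words through a point and the negative error are PuncturedLYMChainNeg2; the assembly
(`puncturedNMP_of_cert2`) is PuncturedLYMChainAssembly.  Nothing here asserts (SP) in general.
-/

namespace PercRepro.PuncturedLYM

open Finset

variable {α : Type} [Fintype α] [DecidableEq α]

/-! ### The abstract certificate inequality -/

/-- **The abstract certificate inequality.** Sequences `m, s ≥ 0` with `A_a·m_a + C_a·m_{a+1} ≤ s_a` and a certificate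
`λ ≥ 0` with `w_a ≤ A_a·λ_a + C_{a−1}·λ_{a−1}` (`C_{−1} := 0`) give `Σ_{a<K} m_a w_a + C_{K−1}·λ_{K−1}·m_K ≤ Σ_{a<K} λ_a s_a`
for `1 ≤ K`. -/
theorem cert_sum_le (m w s A C lam : ℕ → ℚ) (hm : ∀ a, 0 ≤ m a) (hlam : ∀ a, 0 ≤ lam a)
    (hpack : ∀ a, A a * m a + C a * m (a + 1) ≤ s a)
    (hcert0 : w 0 ≤ A 0 * lam 0) (hcert : ∀ a, w (a + 1) ≤ A (a + 1) * lam (a + 1) + C a * lam a) :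
    ∀ K, 1 ≤ K → ∑ a ∈ range K, m a * w a + C (K - 1) * lam (K - 1) * m K ≤ ∑ a ∈ range K, lam a * s a := by
  intro K hK
  induction K, hK using Nat.le_induction with
  | base =>
    simp only [sum_range_one, Nat.sub_self]
    have h1 := mul_le_mul_of_nonneg_left hcert0 (hm 0)
    have h2 := mul_le_mul_of_nonneg_left (hpack 0) (hlam 0)
    nlinarith
  | succ k hk ih =>
    rw [sum_range_succ, sum_range_succ, Nat.add_sub_cancel]
    obtain ⟨k', rfl⟩ : ∃ k', k = k' + 1 := ⟨k - 1, by omega⟩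
    rw [Nat.add_sub_cancel] at ih
    have h1 := mul_le_mul_of_nonneg_left (hcert k') (hm (k' + 1))
    have h2 := mul_le_mul_of_nonneg_left (hpack (k' + 1)) (hlam (k' + 1))
    nlinarith

/-! ### The words through a point -/

/-- `g(a) = (n − 2j + a)·dFlux a`, the surplus (in units of `1/(n−j)`) of the radial coupling at an inside completion. -/
def gDef (α : Type) [Fintype α] (j a : ℕ) : ℚ := ((Fintype.card α : ℚ) - 2 * j + a) * dFlux α j a

omit [DecidableEq α] in
/-- `0 ≤ g(a)` for `2j ≤ n`, `j ≤ n`. -/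
theorem gDef_nonneg {j a : ℕ} (hn : 2 * j ≤ Fintype.card α) : 0 ≤ gDef α j a := by
  unfold gDef
  apply mul_nonneg _ (dFlux_nonneg (by omega))
  have : (2 * j : ℚ) ≤ Fintype.card α := by exact_mod_cast hn
  have : (0 : ℚ) ≤ a := by positivity
  linarith

/-- The words through `x` at distance `a` from `B`. -/
def throughCount (D : Finset (Finset α)) (B : Finset α) (x : α) (a : ℕ) : ℕ :=
  (D.filter (fun B' => x ∈ B' ∧ (B ∩ B').card = a)).card

/-- The `(j−1)`-sets through `x` meeting `B` in `a` points. -/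
def midSetsAt (α : Type) [Fintype α] [DecidableEq α] (j : ℕ) (B : Finset α) (x : α) (a : ℕ) :
    Finset (Finset α) :=
  ((univ : Finset α).powersetCard (j - 1)).filter (fun S => x ∈ S ∧ (S ∩ B).card = a)

/-- `#midSetsAt ≤ C(j, a)·C(n − j − 1, j − 2 − a)` for a `j`-set `B` and `x ∉ B` (`a + 2 ≤ j`): `S ↦ (S ∩ B, S ∖ (B ∪ {x}))`
is injective. -/
theorem card_midSetsAt_le {j : ℕ} {B : Finset α} (hB : B.card = j) {x : α} (hx : x ∉ B) {a : ℕ} (ha : a + 2 ≤ j) :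
    (midSetsAt α j B x a).card ≤ j.choose a * (Fintype.card α - j - 1).choose (j - 2 - a) := by
  have hinj : Set.InjOn (fun S : Finset α => (S ∩ B, S \ insert x B))
      (midSetsAt α j B x a : Set (Finset α)) := by
    intro S hS T hT h
    simp only [mem_coe, midSetsAt, mem_filter, mem_powersetCard] at hS hT
    simp only [Prod.mk.injEq] at h
    ext w
    by_cases hwx : w = x
    · subst hwx
      exact ⟨fun _ => hT.2.1, fun _ => hS.2.1⟩
    by_cases hwB : w ∈ B
    · have h1 : w ∈ S ↔ w ∈ S ∩ B := by simp [hwB]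
      have h2 : w ∈ T ↔ w ∈ T ∩ B := by simp [hwB]
      rw [h1, h2, h.1]
    · have h1 : w ∈ S ↔ w ∈ S \ insert x B := by simp [hwB, hwx]
      have h2 : w ∈ T ↔ w ∈ T \ insert x B := by simp [hwB, hwx]
      rw [h1, h2, h.2]
  have hsub : (midSetsAt α j B x a).image (fun S : Finset α => (S ∩ B, S \ insert x B)) ⊆
      (B.powersetCard a) ×ˢ ((univ \ insert x B).powersetCard (j - 2 - a)) := by
    intro p hp
    rw [mem_image] at hp
    obtain ⟨S, hS, rfl⟩ := hp
    simp only [midSetsAt, mem_filter, mem_powersetCard] at hS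
    rw [mem_product, mem_powersetCard, mem_powersetCard]
    refine ⟨⟨inter_subset_right, hS.2.2⟩, ⟨?_, ?_⟩⟩
    · intro w hw
      rw [mem_sdiff] at hw ⊢
      exact ⟨mem_univ w, hw.2⟩
    · -- `#(S ∖ (B ∪ {x})) = #S − #(S ∩ B) − 1`
      have h1 : S \ insert x B = (S \ B).erase x := by
        ext w
        simp only [mem_sdiff, mem_insert, mem_erase, not_or]
        tauto
      have hxS : x ∈ S \ B := mem_sdiff.2 ⟨hS.2.1, hx⟩
      rw [h1, card_erase_of_mem hxS]
      have := card_sdiff_add_card_inter S B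
      omega
  calc (midSetsAt α j B x a).card
      = ((midSetsAt α j B x a).image (fun S : Finset α => (S ∩ B, S \ insert x B))).card :=
        (card_image_of_injOn hinj).symm
    _ ≤ ((B.powersetCard a) ×ˢ ((univ \ insert x B).powersetCard (j - 2 - a))).card := card_le_card hsub
    _ = j.choose a * (Fintype.card α - j - 1).choose (j - 2 - a) := by
        rw [card_product, card_powersetCard, card_powersetCard, hB, card_univ_sdiff,
          card_insert_of_notMem hx, hB]
        rfl

/-- The pairs `(B', p)`: words through `x` at distance `a` from `B` with `p ∈ B' ∖ (B ∪ {x})`, and words through `x` at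
distance `a + 1` with `p ∈ B' ∩ B`. -/
def pairsAt (D : Finset (Finset α)) (B : Finset α) (x : α) (a : ℕ) : Finset (Σ _ : Finset α, α) :=
  (D.filter (fun B' => x ∈ B' ∧ (B ∩ B').card = a)).sigma (fun B' => B' \ insert x B) ∪
    (D.filter (fun B' => x ∈ B' ∧ (B ∩ B').card = a + 1)).sigma (fun B' => B' ∩ B)

/-- **The joint packing count through a point**: `(j − 1 − a)·m'_a + (a + 1)·m'_{a+1} ≤ #midSetsAt a` for a code `D`, a
word `B ∈ D`... in fact any `j`-set `B` and `x ∉ B` (`a + 2 ≤ j`). -/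
theorem card_through_pair_le {j : ℕ} {D : Finset (Finset α)} (hD : IsCode j D) {B : Finset α} (hB : B.card = j)
    {x : α} (hx : x ∉ B) {a : ℕ} (ha : a + 2 ≤ j) :
    throughCount D B x a * (j - 1 - a) + throughCount D B x (a + 1) * (a + 1) ≤ (midSetsAt α j B x a).card := by
  have hcard : (pairsAt D B x a).card = throughCount D B x a * (j - 1 - a) + throughCount D B x (a + 1) * (a + 1) := by
    unfold pairsAt throughCount
    rw [card_union_of_disjoint]
    · congr 1
      · rw [card_sigma]
        have : ∀ B' ∈ D.filter (fun B' => x ∈ B' ∧ (B ∩ B').card = a), (B' \ insert x B).card = j - 1 - a := by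
          intro B' hB'
          rw [mem_filter] at hB'
          have h1 : B' \ insert x B = (B' \ B).erase x := by
            ext w
            simp only [mem_sdiff, mem_insert, mem_erase, not_or]
            tauto
          have hxB' : x ∈ B' \ B := mem_sdiff.2 ⟨hB'.2.1, hx⟩
          rw [h1, card_erase_of_mem hxB']
          have h2 := card_sdiff_add_card_inter B' B
          rw [inter_comm, hB'.2.2, hD.1 B' hB'.1] at h2
          omega
        rw [sum_congr rfl this, sum_const, smul_eq_mul]
      · rw [card_sigma]
        have : ∀ B' ∈ D.filter (fun B' => x ∈ B' ∧ (B ∩ B').card = a + 1), (B' ∩ B).card = a + 1 := by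
          intro B' hB'
          rw [mem_filter] at hB'
          rw [inter_comm]
          exact hB'.2.2
        rw [sum_congr rfl this, sum_const, smul_eq_mul]
    · rw [disjoint_left]
      rintro ⟨B', p⟩ h1 h2
      simp only [mem_sigma, mem_filter] at h1 h2
      omega
  rw [← hcard]
  have hinj : Set.InjOn (fun p : Σ _ : Finset α, α => p.1.erase p.2) (pairsAt D B x a : Set _) := by
    rintro ⟨B₁, p⟩ hp ⟨B₂, p'⟩ hp' h
    simp only [mem_coe, pairsAt, mem_union, mem_sigma, mem_filter] at hp hp'
    have h' : B₁.erase p = B₂.erase p' := h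
    have hB₁D : B₁ ∈ D := by rcases hp with ⟨⟨h, -⟩, -⟩ | ⟨⟨h, -⟩, -⟩ <;> exact h
    have hB₂D : B₂ ∈ D := by rcases hp' with ⟨⟨h, -⟩, -⟩ | ⟨⟨h, -⟩, -⟩ <;> exact h
    have hpB : p ∈ B₁ := by
      rcases hp with ⟨-, h⟩ | ⟨-, h⟩
      · exact (mem_sdiff.1 h).1
      · exact (mem_inter.1 h).1
    have hp'B : p' ∈ B₂ := by
      rcases hp' with ⟨-, h⟩ | ⟨-, h⟩
      · exact (mem_sdiff.1 h).1
      · exact (mem_inter.1 h).1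
    have hBB : B₁ = B₂ := by
      by_contra hne
      have h1 := hD.2 B₁ hB₁D B₂ hB₂D hne
      have h2 : B₁.erase p ⊆ B₁ ∩ B₂ := by
        intro w hw
        rw [mem_inter]
        refine ⟨mem_of_mem_erase hw, ?_⟩
        rw [h'] at hw
        exact mem_of_mem_erase hw
      have := card_le_card h2
      rw [card_erase_of_mem hpB, hD.1 B₁ hB₁D] at this
      omega
    subst hBB
    have hpp' : p = p' := erase_injOn B₁ hpB hp'B h'
    rw [hpp']
  have hsub : (pairsAt D B x a).image (fun p : Σ _ : Finset α, α => p.1.erase p.2) ⊆ midSetsAt α j B x a := by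
    intro S hS
    rw [mem_image] at hS
    obtain ⟨⟨B', p⟩, hp, rfl⟩ := hS
    simp only [pairsAt, mem_union, mem_sigma, mem_filter] at hp
    rw [midSetsAt, mem_filter, mem_powersetCard]
    rcases hp with ⟨⟨hB'D, hxB', hBa⟩, hp⟩ | ⟨⟨hB'D, hxB', hBa⟩, hp⟩
    · have hpB' : p ∈ B' := (mem_sdiff.1 hp).1
      have hpnot : p ∉ insert x B := (mem_sdiff.1 hp).2
      have hpx : p ≠ x := fun h => hpnot (h ▸ mem_insert_self x B)
      have hpB : p ∉ B := fun h => hpnot (mem_insert_of_mem h)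
      refine ⟨⟨subset_univ _, by rw [card_erase_of_mem hpB', hD.1 B' hB'D]⟩, mem_erase.2 ⟨hpx.symm, hxB'⟩, ?_⟩
      have : B'.erase p ∩ B = B ∩ B' := by
        ext w
        simp only [mem_inter, mem_erase]
        constructor
        · rintro ⟨⟨-, hwB'⟩, hwB⟩
          exact ⟨hwB, hwB'⟩
        · rintro ⟨hwB, hwB'⟩
          exact ⟨⟨fun h => hpB (h ▸ hwB), hwB'⟩, hwB⟩
      rw [this, hBa]
    · have hpB' : p ∈ B' := (mem_inter.1 hp).1
      have hpB : p ∈ B := (mem_inter.1 hp).2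
      have hpx : p ≠ x := fun h => hx (h ▸ hpB)
      refine ⟨⟨subset_univ _, by rw [card_erase_of_mem hpB', hD.1 B' hB'D]⟩, mem_erase.2 ⟨hpx.symm, hxB'⟩, ?_⟩
      have : B'.erase p ∩ B = (B ∩ B').erase p := by
        ext w
        simp only [mem_inter, mem_erase]
        tauto
      rw [this, card_erase_of_mem (mem_inter.2 ⟨hpB, hpB'⟩), hBa]
      rfl
  calc (pairsAt D B x a).card = ((pairsAt D B x a).image (fun p : Σ _ : Finset α, α => p.1.erase p.2)).card :=
        (card_image_of_injOn hinj).symm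
    _ ≤ (midSetsAt α j B x a).card := card_le_card hsub

end PercRepro.PuncturedLYM
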